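import Summits.ResolutionOfSingularities.ResolutionOfSingularities.Theorems.PurelyInseparableDim4ResConeVertexDrop
import HarnessLib
import HarnessLib.Audit.Tags

/-!
# Purely inseparable four-folds — the TAME CONE AT A CONSTANT-`d` STEP, IV: (SAT-UNIQUE) — with a
# rank-`≤ 2` polar kernel all shade-keeping SATELLITE successors share ONE direction

[OURS · counted 0 · cell `res-dim4-pi` · desk WORD #66 (2) (K2(p) lower-band lane) · seat res-dim4-p-5 g2 on
p-12 g2's named signature «p-5 take `ResCone.satellite_directions_dependent_of_finrank_le_two`» · K lane
crit-4 g2 (K-A4).]  Nothing here proves K2(p), `NoIsolatedTrap p p` or resolution of singularities in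
dimension ≥ 4 / characteristic `p`.

Setting (`…ResCone*`, p-12 g2): presented state `s` in the band (`x^r ∣ F`, `q < ord₀ F = o < 2q`), residual
cone `g = resForm s` with POLAR KERNEL `resVertex s` (`e_G(s) := finrank (resVertex s)`), a shade-keeping point
step `s →(j₀, b₀) s′` and shade-keeping second steps `s′ →(j, b) s″`; such a second step is a SATELLITE of
the first when `j ≠ j₀ ∧ b_{j₀} = 0` (its chart point lies on the new exceptional hyperplane `{w_{j₀} = 0}`).

This is the `e_G = 2` analogue of (E1-FREE) (`ResCone.not_satellite_of_finrank_le_one`, p669278) — the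
constraint (SAT-UNIQUE) of idea-4 I-4-7's located residual `{d ∈ {3,4}, e_G ≡ 2}`:

* **`satellite_directions_dependent_of_finrank_le_two`** — if `e_G(s) ≤ 2`, any two shade-keeping satellite
  second steps `(j₁, b₁)`, `(j₂, b₂)` out of `s′` have PROPORTIONAL directions,
  `direction j₂ b₂ = c • direction j₁ b₁`: both directions lie in `resVertex s′` ((VT)(i)) and in
  `{w_{j₀} = 0}`, a subspace of rank `≤ e_G(s) − 1 ≤ 1` by the trace bound
  `finrank_resVertex_step_inf_hyperplane_add_one_le` ((VT)(iii));
* **`satellite_point_eq_of_chart_eq`** — hence in a given chart there is AT MOST ONE shade-keeping satellite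
  chart point (`j₂ = j₁ ⇒ b₂ = b₁`);
* **`satellite_apply_mul_apply_eq_one`**, **`satellite_point_eq_of_chart_ne`** — and across two different
  charts the satellite points determine each other (`b₂ j₁ * b₁ j₂ = 1`,
  `b₂ = update ((b₁ j₂)⁻¹ • direction j₁ b₁) j₂ 0`): at most one satellite DIRECTION per state.

[cite: CossartJannsenSaito2020, Thm. 3.10(4), Thm. 3.14, Thm. 9.3]
bears_on: LADDER-RESOLUTION:D157-DOOR2 (res-dim4-pi · K2(p) = `RidgeBudget.NoAboveFloorTrap p p`, lower band).
Supports stmt-ResolutionOfSingularities-16155 (helper).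
-/

set_option linter.dupNamespace false -- mandated namespace of this single-conjunct summit

noncomputable section

namespace Summit.ResolutionOfSingularities.ResolutionOfSingularities.Theorems.PIDim4

namespace ResCone

open MvPolynomial Finset
open Literature.AlgebraicGeometry.Resolution
open Literature.AlgebraicGeometry.Resolution.CentreBlowup
open Literature.AlgebraicGeometry.Resolution.Hauser2010
open Literature.AlgebraicGeometry.Resolution.HauserPerlega2019
open PointBlowup (polarMap additiveSubspace direction)

variable {K : Type} [Field K]

/-- The direction `e_j + b` of a chart point has `j`-coordinate `1`. [folklore] -/
theorem direction_apply_self (j : Fin 4) (b : Fin 4 → K) : direction j b j = 1 := by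
  unfold direction
  exact Function.update_self ..

/-- The direction `e_j + b` of a chart point agrees with `b` off `j`. [folklore] -/
theorem direction_apply_of_ne {j i : Fin 4} (h : i ≠ j) (b : Fin 4 → K) : direction j b i = b i := by
  unfold direction
  exact Function.update_of_ne h ..

section SatUnique

variable [DecidableEq K]

/-- The direction of a shade-keeping SATELLITE second step `s′ →(j, b) s″` (`j ≠ j₀`, `b_{j₀} = 0`) lies in
the new polar kernel cut by the exceptional hyperplane, `resVertex s′ ⊓ {w_{j₀} = 0}` ((VT)(i)).
[OURS] [cite: CossartJannsenSaito2020, Thm. 3.14] -/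
theorem direction_mem_resVertex_inf_hyperplane_of_satellite {q : ℕ} {j₀ j : Fin 4} {b : Fin 4 → K}
    (hbj : b j = 0) {s' : State K} {o : ℕ} (ho : ordZero s'.F = o) (hr : ∀ d ∈ s'.F.support, s'.r ≤ d)
    (hqo : q < o) (ho2 : o < 2 * q) (heq : (CentreBlowup.step q Finset.univ j b s').shade = s'.shade)
    (hsat : j ≠ j₀ ∧ b j₀ = 0) : direction j b ∈ resVertex s' ⊓ hyperplane j₀ := by
  refine Submodule.mem_inf.mpr ⟨direction_mem_resVertex_of_shade_eq j hbj ho hr hqo ho2 heq,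
    mem_hyperplane.mpr ?_⟩
  rw [direction_apply_of_ne (Ne.symm hsat.1)]
  exact hsat.2

/-- **(SAT-UNIQUE) — with `e_G(s) ≤ 2`, all shade-keeping satellite successors of `s′` have ONE direction.**
Two consecutive shade-keeping band steps `s →(j₀, b₀) s′` and two shade-keeping satellite second steps
`s′ →(j₁, b₁)`, `s′ →(j₂, b₂)` (`j_i ≠ j₀`, `(b_i)_{j₀} = 0`): their directions are proportional.  Both lie in
`resVertex s′ ⊓ {w_{j₀} = 0}`, of rank `≤ e_G(s) − 1 ≤ 1` by the trace bound (VT)(iii).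
[OURS] [cite: CossartJannsenSaito2020, Thm. 3.10(4), Thm. 3.14, Thm. 9.3] -/
theorem satellite_directions_dependent_of_finrank_le_two {q : ℕ} {j₀ j₁ j₂ : Fin 4}
    {b₀ b₁ b₂ : Fin 4 → K} (hb₀ : b₀ j₀ = 0) (hb₁ : b₁ j₁ = 0) (hb₂ : b₂ j₂ = 0) {s : State K}
    {o₀ o₁ : ℕ} (ho₀ : ordZero s.F = o₀) (hr₀ : ∀ d ∈ s.F.support, s.r ≤ d) (hqo₀ : q < o₀)
    (ho₀2 : o₀ < 2 * q) (heq₀ : (CentreBlowup.step q Finset.univ j₀ b₀ s).shade = s.shade)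
    (ho₁ : ordZero (CentreBlowup.step q Finset.univ j₀ b₀ s).F = o₁)
    (hr₁ : ∀ d ∈ (CentreBlowup.step q Finset.univ j₀ b₀ s).F.support,
      (CentreBlowup.step q Finset.univ j₀ b₀ s).r ≤ d)
    (hqo₁ : q < o₁) (ho₁2 : o₁ < 2 * q)
    (heq₁ : (CentreBlowup.step q Finset.univ j₁ b₁ (CentreBlowup.step q Finset.univ j₀ b₀ s)).shade =
      (CentreBlowup.step q Finset.univ j₀ b₀ s).shade)
    (heq₂ : (CentreBlowup.step q Finset.univ j₂ b₂ (CentreBlowup.step q Finset.univ j₀ b₀ s)).shade =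
      (CentreBlowup.step q Finset.univ j₀ b₀ s).shade)
    (hsat₁ : j₁ ≠ j₀ ∧ b₁ j₀ = 0) (hsat₂ : j₂ ≠ j₀ ∧ b₂ j₀ = 0)
    (he : Module.finrank K (resVertex s) ≤ 2) :
    ∃ c : K, direction j₂ b₂ = c • direction j₁ b₁ := by
  have hW : Module.finrank K
      ↥(resVertex (CentreBlowup.step q Finset.univ j₀ b₀ s) ⊓ hyperplane j₀) ≤ 1 := by
    have h := finrank_resVertex_step_inf_hyperplane_add_one_le j₀ hb₀ ho₀ hr₀ hqo₀ ho₀2 heq₀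
    omega
  have h₁ := direction_mem_resVertex_inf_hyperplane_of_satellite hb₁ ho₁ hr₁ hqo₁ ho₁2 heq₁ hsat₁
  have h₂ := direction_mem_resVertex_inf_hyperplane_of_satellite hb₂ ho₁ hr₁ hqo₁ ho₁2 heq₂ hsat₂
  have hW1 : Module.finrank K
      ↥(resVertex (CentreBlowup.step q Finset.univ j₀ b₀ s) ⊓ hyperplane j₀) = 1 := by
    by_contra hne
    have h0 : resVertex (CentreBlowup.step q Finset.univ j₀ b₀ s) ⊓ hyperplane j₀ = ⊥ :=
      Submodule.finrank_eq_zero.mp (by omega)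
    have h₁' := h₁
    rw [h0, Submodule.mem_bot] at h₁'
    exact Directrix.direction_ne_zero j₁ b₁ h₁'
  have hnz : (⟨direction j₁ b₁, h₁⟩ :
      ↥(resVertex (CentreBlowup.step q Finset.univ j₀ b₀ s) ⊓ hyperplane j₀)) ≠ 0 :=
    fun h => Directrix.direction_ne_zero j₁ b₁ (congrArg Subtype.val h)
  obtain ⟨c, hc⟩ := (finrank_eq_one_iff_of_nonzero' _ hnz).mp hW1 ⟨direction j₂ b₂, h₂⟩
  exact ⟨c, (congrArg Subtype.val hc).symm⟩

/-- **At most one shade-keeping satellite chart point PER CHART** (`e_G(s) ≤ 2`): two shade-keeping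
satellite second steps out of `s′` in the same chart have the same chart point. [OURS]
[cite: CossartJannsenSaito2020, Thm. 3.14] -/
theorem satellite_point_eq_of_chart_eq {q : ℕ} {j₀ j₁ j₂ : Fin 4} {b₀ b₁ b₂ : Fin 4 → K}
    (hb₀ : b₀ j₀ = 0) (hb₁ : b₁ j₁ = 0) (hb₂ : b₂ j₂ = 0) {s : State K} {o₀ o₁ : ℕ}
    (ho₀ : ordZero s.F = o₀) (hr₀ : ∀ d ∈ s.F.support, s.r ≤ d) (hqo₀ : q < o₀) (ho₀2 : o₀ < 2 * q)
    (heq₀ : (CentreBlowup.step q Finset.univ j₀ b₀ s).shade = s.shade)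
    (ho₁ : ordZero (CentreBlowup.step q Finset.univ j₀ b₀ s).F = o₁)
    (hr₁ : ∀ d ∈ (CentreBlowup.step q Finset.univ j₀ b₀ s).F.support,
      (CentreBlowup.step q Finset.univ j₀ b₀ s).r ≤ d)
    (hqo₁ : q < o₁) (ho₁2 : o₁ < 2 * q)
    (heq₁ : (CentreBlowup.step q Finset.univ j₁ b₁ (CentreBlowup.step q Finset.univ j₀ b₀ s)).shade =
      (CentreBlowup.step q Finset.univ j₀ b₀ s).shade)
    (heq₂ : (CentreBlowup.step q Finset.univ j₂ b₂ (CentreBlowup.step q Finset.univ j₀ b₀ s)).shade =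
      (CentreBlowup.step q Finset.univ j₀ b₀ s).shade)
    (hsat₁ : j₁ ≠ j₀ ∧ b₁ j₀ = 0) (hsat₂ : j₂ ≠ j₀ ∧ b₂ j₀ = 0)
    (he : Module.finrank K (resVertex s) ≤ 2) (hj : j₂ = j₁) : b₂ = b₁ := by
  subst hj
  obtain ⟨c, hc⟩ := satellite_directions_dependent_of_finrank_le_two hb₀ hb₁ hb₂ ho₀ hr₀ hqo₀ ho₀2 heq₀
    ho₁ hr₁ hqo₁ ho₁2 heq₁ heq₂ hsat₁ hsat₂ he
  have hc1 : c = 1 := by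
    have h := congr_fun hc j₂
    rw [Pi.smul_apply, direction_apply_self, direction_apply_self, smul_eq_mul, mul_one] at h
    exact h.symm
  rw [hc1, one_smul] at hc
  funext i
  by_cases hi : i = j₂
  · rw [hi, hb₂, hb₁]
  · have h := congr_fun hc i
    rwa [direction_apply_of_ne hi, direction_apply_of_ne hi] at h

/-- **Satellite points in two different charts determine each other, I** (`e_G(s) ≤ 2`): for shade-keeping
satellite second steps `(j₁, b₁)`, `(j₂, b₂)` out of `s′` with `j₂ ≠ j₁`, `b₂ j₁ * b₁ j₂ = 1` (so both
cross-coordinates are non-zero). [OURS] [cite: CossartJannsenSaito2020, Thm. 3.14] -/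
theorem satellite_apply_mul_apply_eq_one {q : ℕ} {j₀ j₁ j₂ : Fin 4} {b₀ b₁ b₂ : Fin 4 → K}
    (hb₀ : b₀ j₀ = 0) (hb₁ : b₁ j₁ = 0) (hb₂ : b₂ j₂ = 0) {s : State K} {o₀ o₁ : ℕ}
    (ho₀ : ordZero s.F = o₀) (hr₀ : ∀ d ∈ s.F.support, s.r ≤ d) (hqo₀ : q < o₀) (ho₀2 : o₀ < 2 * q)
    (heq₀ : (CentreBlowup.step q Finset.univ j₀ b₀ s).shade = s.shade)
    (ho₁ : ordZero (CentreBlowup.step q Finset.univ j₀ b₀ s).F = o₁)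
    (hr₁ : ∀ d ∈ (CentreBlowup.step q Finset.univ j₀ b₀ s).F.support,
      (CentreBlowup.step q Finset.univ j₀ b₀ s).r ≤ d)
    (hqo₁ : q < o₁) (ho₁2 : o₁ < 2 * q)
    (heq₁ : (CentreBlowup.step q Finset.univ j₁ b₁ (CentreBlowup.step q Finset.univ j₀ b₀ s)).shade =
      (CentreBlowup.step q Finset.univ j₀ b₀ s).shade)
    (heq₂ : (CentreBlowup.step q Finset.univ j₂ b₂ (CentreBlowup.step q Finset.univ j₀ b₀ s)).shade =
      (CentreBlowup.step q Finset.univ j₀ b₀ s).shade)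
    (hsat₁ : j₁ ≠ j₀ ∧ b₁ j₀ = 0) (hsat₂ : j₂ ≠ j₀ ∧ b₂ j₀ = 0)
    (he : Module.finrank K (resVertex s) ≤ 2) (hj : j₂ ≠ j₁) : b₂ j₁ * b₁ j₂ = 1 := by
  obtain ⟨c, hc⟩ := satellite_directions_dependent_of_finrank_le_two hb₀ hb₁ hb₂ ho₀ hr₀ hqo₀ ho₀2 heq₀
    ho₁ hr₁ hqo₁ ho₁2 heq₁ heq₂ hsat₁ hsat₂ he
  have h1 := congr_fun hc j₁
  rw [Pi.smul_apply, direction_apply_of_ne (Ne.symm hj), direction_apply_self, smul_eq_mul, mul_one] at h1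
  have h2 := congr_fun hc j₂
  rw [Pi.smul_apply, direction_apply_self, direction_apply_of_ne hj, smul_eq_mul] at h2
  rw [h1, ← h2]

/-- **Satellite points in two different charts determine each other, II** (`e_G(s) ≤ 2`): with `j₂ ≠ j₁`
the satellite chart point of the `x_{j₂}`-chart is `b₂ = update ((b₁ j₂)⁻¹ • direction j₁ b₁) j₂ 0` — so `s′`
has AT MOST ONE shade-keeping satellite direction, read in any chart. [OURS]
[cite: CossartJannsenSaito2020, Thm. 3.14] -/
theorem satellite_point_eq_of_chart_ne {q : ℕ} {j₀ j₁ j₂ : Fin 4} {b₀ b₁ b₂ : Fin 4 → K}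
    (hb₀ : b₀ j₀ = 0) (hb₁ : b₁ j₁ = 0) (hb₂ : b₂ j₂ = 0) {s : State K} {o₀ o₁ : ℕ}
    (ho₀ : ordZero s.F = o₀) (hr₀ : ∀ d ∈ s.F.support, s.r ≤ d) (hqo₀ : q < o₀) (ho₀2 : o₀ < 2 * q)
    (heq₀ : (CentreBlowup.step q Finset.univ j₀ b₀ s).shade = s.shade)
    (ho₁ : ordZero (CentreBlowup.step q Finset.univ j₀ b₀ s).F = o₁)
    (hr₁ : ∀ d ∈ (CentreBlowup.step q Finset.univ j₀ b₀ s).F.support,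
      (CentreBlowup.step q Finset.univ j₀ b₀ s).r ≤ d)
    (hqo₁ : q < o₁) (ho₁2 : o₁ < 2 * q)
    (heq₁ : (CentreBlowup.step q Finset.univ j₁ b₁ (CentreBlowup.step q Finset.univ j₀ b₀ s)).shade =
      (CentreBlowup.step q Finset.univ j₀ b₀ s).shade)
    (heq₂ : (CentreBlowup.step q Finset.univ j₂ b₂ (CentreBlowup.step q Finset.univ j₀ b₀ s)).shade =
      (CentreBlowup.step q Finset.univ j₀ b₀ s).shade)
    (hsat₁ : j₁ ≠ j₀ ∧ b₁ j₀ = 0) (hsat₂ : j₂ ≠ j₀ ∧ b₂ j₀ = 0)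
    (he : Module.finrank K (resVertex s) ≤ 2) (hj : j₂ ≠ j₁) :
    b₂ = Function.update ((b₁ j₂)⁻¹ • direction j₁ b₁) j₂ 0 := by
  obtain ⟨c, hc⟩ := satellite_directions_dependent_of_finrank_le_two hb₀ hb₁ hb₂ ho₀ hr₀ hqo₀ ho₀2 heq₀
    ho₁ hr₁ hqo₁ ho₁2 heq₁ heq₂ hsat₁ hsat₂ he
  have h2 := congr_fun hc j₂
  rw [Pi.smul_apply, direction_apply_self, direction_apply_of_ne hj, smul_eq_mul] at h2
  -- `c * b₁ j₂ = 1`, so `c = (b₁ j₂)⁻¹`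
  have hb : b₁ j₂ ≠ 0 := fun h => by rw [h, mul_zero] at h2; exact one_ne_zero h2
  have hc' : c = (b₁ j₂)⁻¹ := eq_inv_of_mul_eq_one_left h2.symm
  funext i
  by_cases hi : i = j₂
  · rw [hi, hb₂, Function.update_self]
  · rw [Function.update_of_ne hi, ← direction_apply_of_ne hi b₂, hc, hc']

end SatUnique

end ResCone

end Summit.ResolutionOfSingularities.ResolutionOfSingularities.Theorems.PIDim4

end
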